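import Summits.Ventures.PercRepro.ProfilePointedCircuitClassesInOutParallel

/-!
# PercRepro — THE IN–OUT INEQUALITY AT A LOOP OR A COLOOP (p5, gen 37; the trivial cases of `InOutBottomFour`)

At the bottom level `ν` every bi-independent `ν`-set `W` has a basis `E ∖ W` as complement, so a coloop lies in no
such `W` and a loop in none either: `in_ν(e) = 0`.  With `ProfilePointedCircuitClassesInOutParallel`, the per-point
in–out inequality `in_4(e) ≤ out_5(e)` of nullity `4` is open only at the points that are neither loops nor coloops
and have no parallel twin.
-/

open scoped Matroid

namespace PercRepro.Cogirth

open Finset ThmH Skew Shadow Profile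

variable {α : Type} [DecidableEq α] {N : Matroid α} [N.Finite]

section InOutColoop

/-- A coloop (`ρ(E − e) < ρ(E)`) lies in no bi-independent set of the bottom level `ν = #E − ρ(E)`. -/
theorem inCount_eq_zero_of_coloop {e : α} (hco : rk N ((gr N).erase e) < rk N (gr N)) :
    inCount N ((gr N).card - rk N (gr N)) e = 0 := by
  unfold inCount
  rw [card_eq_zero, filter_eq_empty_iff]
  intro W hW heW
  rw [mem_biIndepSets] at hW
  obtain ⟨hWg, hWcard, _, hWcompl⟩ := hW
  -- `E ∖ W ⊆ E − e` has rank `#(E ∖ W) = ρ(E)`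
  have hsub : gr N \ W ⊆ (gr N).erase e := by
    intro a ha
    rw [mem_sdiff] at ha
    rw [mem_erase]
    exact ⟨fun h => ha.2 (h ▸ heW), ha.1⟩
  have h1 : rk N (gr N \ W) ≤ rk N ((gr N).erase e) := rk_le_rk_of_subset_finset hsub
  have h2 : (gr N \ W).card = rk N (gr N) := by
    rw [card_sdiff_of_subset hWg, hWcard]
    have := card_le_card hWg
    have := rk_le_card (M := N) (gr N)
    omega
  rw [hWcompl, h2] at h1
  omega

/-- **THE COLOOP CASE OF `InOutBottomFour`**: `in_4(e) = 0 ≤ out_5(e)` on `#E = ρ(E) + 4` when `e` is a coloop. -/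
theorem inCount_four_le_outCount_five_of_coloop (hn : (gr N).card = rk N (gr N) + 4) {e : α}
    (hco : rk N ((gr N).erase e) < rk N (gr N)) : inCount N 4 e ≤ outCount N 5 e := by
  have h := inCount_eq_zero_of_coloop hco
  have e4 : (gr N).card - rk N (gr N) = 4 := by omega
  rw [e4] at h
  rw [h]
  exact Nat.zero_le _

/-- **THE LOOP CASE OF `InOutBottomFour`**: `in_4(e) = 0 ≤ out_5(e)` when `e` is a loop (p10's
`inCount_eq_zero_of_rk_ne_one`). -/
theorem inCount_four_le_outCount_five_of_loop {e : α} (hl : rk N {e} = 0) : inCount N 4 e ≤ outCount N 5 e := by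
  rw [inCount_eq_zero_of_rk_ne_one e 4 (by omega)]
  exact Nat.zero_le _

end InOutColoop

end PercRepro.Cogirth
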